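import Mathlib
import Summits.NavierStokesRegularity.NavierStokesRegularity.Theorems.HeteroclinicTriggerChainTriggerChainFrontStepTruncWindows
import HarnessLib

/-!
# `HeteroclinicTriggerChain` — crux `TriggerChainFrontStep` (item stmt-NavierStokesRegularity-22785):
  window estimates of the delay phase WITH ADDITIVE FORCING in the carrier and receiver rows

Forced variants of the window lemmas of `…TriggerChainFrontStepTruncWindows`, for the front block of the
LATTICE rather than the bare truncation: on the lattice the carrier row receives the wake pump
`+2^{−5/2}e·u₋₁² ≥ 0` from the shell behind and `O(β)` table remainders, and the receiver row loses seed work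
to the shell ahead (sibling seats' row formulas `…ConnectionAlgebra`, `…SectorRows`, `…CarrierRow`); these are
ADDITIVE forcings `f₁`, `f₃` of known size, while the remainders of the trigger rows are multiplicative and
are already covered by the abstract rate `u′ = r·u` / the arbitrary coefficient functions of
`v′ = β·x·u + e′·y·v` in the unforced lemmas. Here:
* `htcTP_carrier_upper_forced` — `x′ = −eu² − βuv + f₁`, `f₁ ≤ φ₁`, `u, v ≥ 0` ⇒ `x(s) ≤ x(0) + φ₁s`
  (with forcing the carrier is no longer capped by the energy);
* `htcTP_carrier_window_forced` — `f₁ ≥ −φ₁`, `u′ = ru`, `r ≥ e/2`, `0 ≤ v ≤ V` ⇒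
  `x(s) ≥ x(0) − (u² − u(0)²) − 2βV(u − u(0))/e − φ₁s`;
* `htcTP_receiver_window_forced` — `y′ = gu² − e′v² + f₃`, `|f₃| ≤ φ₃`, `r ≥ e/2`, pump beats drain ⇒
  `y(0) − φ₃s ≤ y(s) ≤ y(0) + g(u² − u(0)²)/e + φ₃s`.
All proofs are monotonicity identities for explicit combinations (no ODE uniqueness, no integrals).

HONEST FRAMING: elementary real-analysis facts about scalar ODE combinations (MODEL truncation / front block
of Tao's lattice, Tao 2016 §4); helper lemmas for the crux, no stub credit; nothing here is a statement about
the Navier–Stokes equations; no summit, rung or crux is proved. NS regularity is not proved by this line.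
-/

noncomputable section

-- the sub-problem namespace `Summit.NavierStokesRegularity.NavierStokesRegularity` repeats the summit name by design (D-0017)
set_option linter.dupNamespace false

open Real Set

namespace Summit.NavierStokesRegularity.NavierStokesRegularity.Theorems

/-- **Carrier ceiling under forcing**: if `x′ = −eu² − βuv + f₁` with `f₁ ≤ φ₁`, `e, β ≥ 0`, `v ≥ 0` on
`[0, t]` (and any `u`, since `u²` and `βuv` enter with `u ≥ 0`), then `x(s) ≤ x(0) + φ₁ s` on `[0, t]`.
[folklore] -/
theorem htcTP_carrier_upper_forced {x u v f₁ : ℝ → ℝ} {e β φ₁ : ℝ} (he : 0 ≤ e) (hβ : 0 ≤ β)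
    (hx : ∀ s, HasDerivAt x (-(e * u s ^ 2) - β * u s * v s + f₁ s) s) (hunn : ∀ s, 0 ≤ u s)
    {t : ℝ} (hf₁ : ∀ s ∈ Icc 0 t, f₁ s ≤ φ₁) (hvnn : ∀ s ∈ Icc 0 t, 0 ≤ v s) :
    ∀ s ∈ Icc 0 t, x s ≤ x 0 + φ₁ * s := by
  have hQ : ∀ s, HasDerivAt (fun q => x q - φ₁ * q) ((-(e * u s ^ 2) - β * u s * v s + f₁ s) - φ₁ * 1) s :=
    fun s => (hx s).sub ((hasDerivAt_id' s).const_mul φ₁)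
  have hQ' : ∀ s ∈ Icc 0 t, (-(e * u s ^ 2) - β * u s * v s + f₁ s) - φ₁ * 1 ≤ 0 := by
    intro s hs
    have h1 : 0 ≤ e * u s ^ 2 := by positivity
    have h2 : 0 ≤ β * u s * v s := mul_nonneg (mul_nonneg hβ (hunn s)) (hvnn s hs)
    linarith [hf₁ s hs]
  have hQle := htcTP_le_of_deriv_nonpos hQ hQ'
  intro s hs
  have h1 := hQle s hs
  simp only [mul_zero, sub_zero] at h1
  linarith

/-- **Carrier drift under forcing**: if `x′ = −eu² − βuv + f₁` with `f₁ ≥ −φ₁` on `[0, t]`, `u′ = ru` with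
`r ≥ e/2` on `[0, t]`, `u ≥ 0`, and `v ≤ V` on `[0, t]` (`V ≥ 0`), then
`x(s) ≥ x(0) − (u(s)² − u(0)²) − 2βV(u(s) − u(0))/e − φ₁ s` on `[0, t]`
(`P = e·x + e·u² + 2βV·u + eφ₁·s` is non-decreasing). [folklore] -/
theorem htcTP_carrier_window_forced {x u v r f₁ : ℝ → ℝ} {e β V φ₁ : ℝ} (he : 0 < e) (hβ : 0 ≤ β)
    (hV : 0 ≤ V) (hx : ∀ s, HasDerivAt x (-(e * u s ^ 2) - β * u s * v s + f₁ s) s)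
    (hu' : ∀ s, HasDerivAt u (r s * u s) s) (hunn : ∀ s, 0 ≤ u s)
    {t : ℝ} (hr : ∀ s ∈ Icc 0 t, e / 2 ≤ r s) (hvV : ∀ s ∈ Icc 0 t, v s ≤ V)
    (hf₁ : ∀ s ∈ Icc 0 t, -φ₁ ≤ f₁ s) :
    ∀ s ∈ Icc 0 t, x 0 - (u s ^ 2 - u 0 ^ 2) - 2 * β * V * (u s - u 0) / e - φ₁ * s ≤ x s := by
  have hu2 : ∀ s, HasDerivAt (fun q => u q ^ 2) (2 * u s * (r s * u s)) s := by
    intro s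
    have h1 := (hu' s).mul (hu' s)
    have h2 : (fun q => u q ^ 2) = fun q => u q * u q := funext fun q => sq (u q)
    rw [h2]
    exact h1.congr_deriv (by ring)
  have hP : ∀ s, HasDerivAt (fun q => e * x q + e * u q ^ 2 + 2 * β * V * u q + e * φ₁ * q)
      (e * (-(e * u s ^ 2) - β * u s * v s + f₁ s) + e * (2 * u s * (r s * u s)) +
        2 * β * V * (r s * u s) + e * φ₁ * 1) s :=
    fun s => ((((hx s).const_mul e).add ((hu2 s).const_mul e)).add ((hu' s).const_mul _)).add
      ((hasDerivAt_id' s).const_mul _)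
  have hP' : ∀ s ∈ Icc 0 t, 0 ≤ e * (-(e * u s ^ 2) - β * u s * v s + f₁ s) +
      e * (2 * u s * (r s * u s)) + 2 * β * V * (r s * u s) + e * φ₁ * 1 := by
    intro s hs
    have hus := hunn s
    have hrs : 0 ≤ r s - e / 2 := by linarith [hr s hs]
    have h1 : e * (-(e * u s ^ 2) - β * u s * v s + f₁ s) + e * (2 * u s * (r s * u s)) +
        2 * β * V * (r s * u s) + e * φ₁ * 1 =
        2 * e * u s ^ 2 * (r s - e / 2) + 2 * β * V * u s * (r s - e / 2) + e * β * u s * (V - v s) +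
          e * (f₁ s + φ₁) := by
      ring
    rw [h1]
    have h2 : 0 ≤ V - v s := by linarith [hvV s hs]
    have h3 : 0 ≤ f₁ s + φ₁ := by linarith [hf₁ s hs]
    positivity
  have hPle := htcTP_le_of_deriv_nonneg hP hP'
  intro s hs
  have h1 := hPle s hs
  simp only [mul_zero, add_zero] at h1
  have h2 : x 0 - (u s ^ 2 - u 0 ^ 2) - 2 * β * V * (u s - u 0) / e - φ₁ * s =
      (e * x 0 - e * (u s ^ 2 - u 0 ^ 2) - 2 * β * V * (u s - u 0) - e * φ₁ * s) / e := by
    field_simp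
  rw [h2, div_le_iff₀ he]
  linarith

/-- **Receiver drift under forcing**: if `y′ = gu² − e′v² + f₃` with `|f₃| ≤ φ₃` on `[0, t]`, `u′ = ru`
with `r ≥ e/2` on `[0, t]`, and the upper drain is dominated by the pump, `e′v² ≤ gu²` on `[0, t]`, then
`y(0) − φ₃ s ≤ y(s) ≤ y(0) + g(u(s)² − u(0)²)/e + φ₃ s` on `[0, t]`. [folklore] -/
theorem htcTP_receiver_window_forced {u y v r f₃ : ℝ → ℝ} {g e e' φ₃ : ℝ} (he : 0 < e) (hg : 0 ≤ g)
    (he' : 0 ≤ e') (hy : ∀ s, HasDerivAt y (g * u s ^ 2 - e' * v s ^ 2 + f₃ s) s)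
    (hu' : ∀ s, HasDerivAt u (r s * u s) s)
    {t : ℝ} (hr : ∀ s ∈ Icc 0 t, e / 2 ≤ r s) (hdrain : ∀ s ∈ Icc 0 t, e' * v s ^ 2 ≤ g * u s ^ 2)
    (hf₃ : ∀ s ∈ Icc 0 t, |f₃ s| ≤ φ₃) :
    ∀ s ∈ Icc 0 t, y 0 - φ₃ * s ≤ y s ∧ y s ≤ y 0 + g * (u s ^ 2 - u 0 ^ 2) / e + φ₃ * s := by
  -- lower: y + φ₃ s non-decreasing
  have hL : ∀ s, HasDerivAt (fun q => y q + φ₃ * q) ((g * u s ^ 2 - e' * v s ^ 2 + f₃ s) + φ₃ * 1) s :=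
    fun s => (hy s).add ((hasDerivAt_id' s).const_mul φ₃)
  have hL' : ∀ s ∈ Icc 0 t, 0 ≤ (g * u s ^ 2 - e' * v s ^ 2 + f₃ s) + φ₃ * 1 := by
    intro s hs
    have h1 := hdrain s hs
    have h2 := (abs_le.1 (hf₃ s hs)).1
    linarith
  have hLle := htcTP_le_of_deriv_nonneg hL hL'
  -- upper: H = e y − g u² − eφ₃ s non-increasing
  have hu2 : ∀ s, HasDerivAt (fun q => u q ^ 2) (2 * u s * (r s * u s)) s := by
    intro s
    have h1 := (hu' s).mul (hu' s)
    have h2 : (fun q => u q ^ 2) = fun q => u q * u q := funext fun q => sq (u q)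
    rw [h2]
    exact h1.congr_deriv (by ring)
  have hH : ∀ s, HasDerivAt (fun q => e * y q - g * u q ^ 2 - e * φ₃ * q)
      (e * (g * u s ^ 2 - e' * v s ^ 2 + f₃ s) - g * (2 * u s * (r s * u s)) - e * φ₃ * 1) s :=
    fun s => (((hy s).const_mul e).sub ((hu2 s).const_mul g)).sub ((hasDerivAt_id' s).const_mul _)
  have hH' : ∀ s ∈ Icc 0 t,
      e * (g * u s ^ 2 - e' * v s ^ 2 + f₃ s) - g * (2 * u s * (r s * u s)) - e * φ₃ * 1 ≤ 0 := by
    intro s hs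
    have h1 : e * (g * u s ^ 2 - e' * v s ^ 2 + f₃ s) - g * (2 * u s * (r s * u s)) - e * φ₃ * 1 =
        -(2 * g * u s ^ 2 * (r s - e / 2)) - e * (e' * v s ^ 2) + e * (f₃ s - φ₃) := by ring
    rw [h1]
    have h2 : 0 ≤ 2 * g * u s ^ 2 * (r s - e / 2) :=
      mul_nonneg (by positivity) (by linarith [hr s hs])
    have h3 : 0 ≤ e * (e' * v s ^ 2) := by positivity
    have h4 : e * (f₃ s - φ₃) ≤ 0 :=
      mul_nonpos_iff.2 (Or.inl ⟨he.le, by linarith [(abs_le.1 (hf₃ s hs)).2]⟩)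
    linarith
  have hHle := htcTP_le_of_deriv_nonpos hH hH'
  intro s hs
  have h1 := hLle s hs
  have h2 := hHle s hs
  simp only [mul_zero, add_zero, sub_zero] at h1 h2
  refine ⟨by linarith, ?_⟩
  have h3 : y 0 + g * (u s ^ 2 - u 0 ^ 2) / e + φ₃ * s =
      (e * y 0 + g * (u s ^ 2 - u 0 ^ 2) + e * φ₃ * s) / e := by
    field_simp
  rw [h3, le_div_iff₀ he]
  linarith

end Summit.NavierStokesRegularity.NavierStokesRegularity.Theorems

end
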